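import Summits.QuantumFields.YangMills.Theorems.VirialFluxGapSharpTwistedLaplaceLogAssembly
import Mathlib.Analysis.SpecialFunctions.Exp
import Mathlib.Analysis.SpecialFunctions.Pow.Real
import HarnessLib

/-!
# Route `SwapVirialDeficit` (YangMills): quantitative Laplace method — W9 BOOKKEEPING
# (bulk + non-negative rest ⟹ the per-sector log law at one `b`; steep-window absorption of polynomial thresholds; exponential tails are polynomial)

Width seat `ym-line-sfw-p2-w2` g58 (cell ym-idea-1, free hands), `--supports stmt-QuantumFields-24197`; the generic arithmetic of brick W9 (assembly into the
hypothesis of ✓`SwapRing.swapGluedStiffness_of_sharpSectorLaplace`, ✓p827608) of the LEAD g97 plan.  The model supplies, at each `b` of the window: the BULK tube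
integral `I_bulk` with the two-sided bound of ✓`laplaceMethod_quantitative_fibred_chart[_cubic]` (`|I_bulk − 𝔐_b| ≤ ε·𝔐_b`, `𝔐_b = (2π∕b)^{m∕2}·𝔐`), and the REST
(far region + tip + ends) `0 ≤ I − I_bulk ≤ ω·𝔐_b` (✓W5 far, (T1)–(T4) tip).  This file turns that into `|log I + (m∕2) log b − C| ≤ 2(ε + ω)`, `C = log 𝔐 + (m∕2) log 2π`
(§1), and does the steep-window arithmetic of (R1) of the memo (§2): a polynomial threshold `b ≥ c·L^k` holds on the window `L ≤ b^{1∕(2k)}`, `b ≥ max 1 c²`, and an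
exponential tail `e^{−bη}` with `η ≥ L^{−j}∕c′` is `≤ c′·b^{aj−1}` there.

* §1 ★★★ `abs_log_sharp_of_bulk_rest` — `I_bulk ≤ I ≤ I_bulk + R`, `|I_bulk − 𝔐_b| ≤ ε𝔐_b`, `R ≤ ω𝔐_b`, `ε + ω ≤ 1∕2` ⟹
  `0 < I ∧ |log I − (log 𝔐 + (m∕2) log(2π) − (m∕2) log b)| ≤ 2(ε + ω)` (✓`abs_log_sub_log_le_of_abs_sub_le` + ✓`log_mul_rpow_div`).
* §2 ★ `mul_pow_le_of_le_rpow_window` — `1 ≤ b`, `c² ≤ b`, `0 < c`, `L ≤ b^{1∕(2k)}` (`k ≥ 1`) ⟹ `c·L^k ≤ b`;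
  ★ `exp_neg_mul_le_of_window` (`e^{−bη} ≤ 1∕(bη) ≤ c′L^j∕b`).  (Already in the tree, not restated: `Tao2016.exp_neg_le_inv` (`e^{−x} ≤ 1∕x`),
  `GuthMaynardZeroDensity.rpow_le_rpow_mul_of_le` (`L^q ≤ b^{aq}` on `L ≤ b^a`).)

HONEST FRAMING: generic real arithmetic; no model object appears; ⟨24197⟩ `SwapGluedStiffness`, ⟨24196⟩, ⟨22884⟩ stay OPEN; no stub ∕ crux ∕ rung ∕ summit is closed; the Yang–Mills mass
gap is NOT proved; no summit is proved by a line.  0 definitions, 0 `sorry`, standard axioms.  References: [folklore].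
-/

set_option linter.style.longLine false
set_option linter.style.longFile 0
set_option linter.unusedSectionVars false

noncomputable section

open _root_.Real

namespace Summit.QuantumFields.YangMills.Theorems.QuantitativeLaplace

/-! ### §1 Bulk + rest ⟹ the log law at one `b` -/

/-- ★★★ **BULK + NON-NEGATIVE REST ⟹ THE SHARP LOG LAW at one value of `b`.**  With the Gaussian main term `𝔐_b = (2π∕b)^{m∕2}·𝔐` (`𝔐 > 0`, `b > 0`):
`I_bulk ≤ I ≤ I_bulk + R`, `|I_bulk − 𝔐_b| ≤ ε·𝔐_b`, `R ≤ ω·𝔐_b`, `ε + ω ≤ 1∕2` ⟹ `0 < I` and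
`|log I − (log 𝔐 + (m∕2)·log(2π) − (m∕2)·log b)| ≤ 2(ε + ω)`. [folklore] -/
theorem abs_log_sharp_of_bulk_rest {I I_bulk R 𝔐 m b ε ω : ℝ} (h𝔐 : 0 < 𝔐) (hb : 0 < b)
    (hlow : I_bulk ≤ I) (hup : I ≤ I_bulk + R)
    (hbulk : |I_bulk - (2 * π / b) ^ (m / 2) * 𝔐| ≤ ε * ((2 * π / b) ^ (m / 2) * 𝔐))
    (hR : R ≤ ω * ((2 * π / b) ^ (m / 2) * 𝔐)) (hsum : ε + ω ≤ 1 / 2) :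
    0 < I ∧ |Real.log I - (Real.log 𝔐 + m / 2 * Real.log (2 * π) - m / 2 * Real.log b)| ≤ 2 * (ε + ω) := by
  set G : ℝ := (2 * π / b) ^ (m / 2) * 𝔐 with hG
  have hGpos : 0 < G := mul_pos (Real.rpow_pos_of_pos (by positivity) _) h𝔐
  have hIG : |I - G| ≤ (ε + ω) * G := by
    obtain ⟨h1, h2⟩ := abs_le.1 hbulk
    rw [abs_le]; constructor <;> nlinarith
  obtain ⟨hIpos, hlog⟩ := abs_log_sub_log_le_of_abs_sub_le hGpos hsum hIG
  refine ⟨hIpos, ?_⟩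
  have hlogG : Real.log G = Real.log 𝔐 + m / 2 * Real.log (2 * π) - m / 2 * Real.log b := by
    rw [hG, mul_comm, log_mul_rpow_div 𝔐 (m / 2) b h𝔐 hb]
  rw [← hlogG]
  exact hlog

/-- ★ **The same with a multiplicative prefactor** `K > 0` on the main term (`𝔐_b = K·(2π∕b)^{m∕2}·𝔐`, e.g. the chart constant `K_L` of the gnomonic ring chart):
conclusion with `C = log K + log 𝔐 + (m∕2) log 2π`. [folklore] -/
theorem abs_log_sharp_of_bulk_rest_const {I I_bulk R 𝔐 K m b ε ω : ℝ} (h𝔐 : 0 < 𝔐) (hK : 0 < K) (hb : 0 < b)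
    (hlow : I_bulk ≤ I) (hup : I ≤ I_bulk + R)
    (hbulk : |I_bulk - K * ((2 * π / b) ^ (m / 2) * 𝔐)| ≤ ε * (K * ((2 * π / b) ^ (m / 2) * 𝔐)))
    (hR : R ≤ ω * (K * ((2 * π / b) ^ (m / 2) * 𝔐))) (hsum : ε + ω ≤ 1 / 2) :
    0 < I ∧ |Real.log I - (Real.log K + Real.log 𝔐 + m / 2 * Real.log (2 * π) - m / 2 * Real.log b)| ≤ 2 * (ε + ω) := by
  have e : K * ((2 * π / b) ^ (m / 2) * 𝔐) = (2 * π / b) ^ (m / 2) * (K * 𝔐) := by ring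
  rw [e] at hbulk hR
  obtain ⟨hI, h⟩ := abs_log_sharp_of_bulk_rest (mul_pos hK h𝔐) hb hlow hup hbulk hR hsum
  refine ⟨hI, ?_⟩
  rw [Real.log_mul hK.ne' h𝔐.ne'] at h
  exact h

/-! ### §2 Steep-window arithmetic -/

/-- ★ **A polynomial threshold holds on a steep window**: `0 < c`, `1 ≤ k`, `1 ≤ b`, `c² ≤ b`, `0 ≤ L ≤ b^{1∕(2k)}` ⟹ `c·L^k ≤ b`
(`L^k ≤ √b` and `c ≤ √b`). [folklore] -/
theorem mul_pow_le_of_le_rpow_window {c b L : ℝ} {k : ℕ} (hc : 0 < c) (hk : 1 ≤ k) (hb1 : 1 ≤ b) (hcb : c ^ 2 ≤ b) (hL0 : 0 ≤ L)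
    (hL : L ≤ b ^ (1 / (2 * (k : ℝ)))) : c * L ^ k ≤ b := by
  have hb0 : 0 < b := by linarith
  have hk0 : (0 : ℝ) < k := by exact_mod_cast hk
  -- `L^k ≤ b^{1/2}`
  have h1 : L ^ k ≤ b ^ (1 / 2 : ℝ) := by
    calc L ^ k ≤ (b ^ (1 / (2 * (k : ℝ)))) ^ k := pow_le_pow_left₀ hL0 hL k
      _ = b ^ (1 / 2 : ℝ) := by
        rw [← Real.rpow_natCast, ← Real.rpow_mul hb0.le]
        congr 1; field_simp
  -- `c ≤ b^{1/2}`
  have h2 : c ≤ b ^ (1 / 2 : ℝ) := by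
    have : c = (c ^ 2) ^ (1 / 2 : ℝ) := by
      rw [← Real.sqrt_eq_rpow, Real.sqrt_sq hc.le]
    rw [this]
    exact Real.rpow_le_rpow (sq_nonneg c) hcb (by norm_num)
  calc c * L ^ k ≤ b ^ (1 / 2 : ℝ) * b ^ (1 / 2 : ℝ) :=
        mul_le_mul h2 h1 (pow_nonneg hL0 k) (Real.rpow_nonneg hb0.le _)
    _ = b := by rw [← Real.rpow_add hb0]; norm_num

/-- ★ **Exponential tail on the window**: `0 < b`, `0 < η` ⟹ `e^{−bη} ≤ 1∕(bη)`; with `η ≥ 1∕(c′L^j)` this is `≤ c′L^j∕b`, polynomial in `L` over `b`. [folklore] -/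
theorem exp_neg_mul_le_of_window {b η c' Lj : ℝ} (hb : 0 < b) (hη : 0 < η) (hc' : 0 < c') (hLj : 0 < Lj) (hηL : 1 / (c' * Lj) ≤ η) :
    Real.exp (-(b * η)) ≤ c' * Lj / b := by
  -- `e^{−x} ≤ 1/x` (`x > 0`; the tree's `Tao2016.exp_neg_le_inv`, inlined to keep the imports light)
  have h1 : Real.exp (-(b * η)) ≤ 1 / (b * η) := by
    rw [Real.exp_neg, one_div]
    exact inv_anti₀ (mul_pos hb hη) (by linarith [Real.add_one_le_exp (b * η)])
  refine h1.trans ?_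
  rw [div_le_div_iff₀ (mul_pos hb hη) hb]
  have : 1 ≤ c' * Lj * η := by
    rw [div_le_iff₀ (mul_pos hc' hLj)] at hηL
    linarith [hηL]
  nlinarith

/-! ### §3 (appended 2026-08-31, same seat) W9 REDUCED TO PER-`(L, b)` DATA: the sharp log law ON THE STEEP WINDOW from polynomial bulk∕rest data

One conjunct of the hypothesis `hSharp` of ✓`SwapRing.swapGluedStiffness_of_sharpSectorLaplace` (✓p827608) per sector: the model supplies, for `L ≥ L₀` and
`b ≥ K₁L^{q₁}`, a bulk part `I_bulk` with `|I_bulk − (2π∕b)^{e(L)}𝔐(L)| ≤ K₂L^{q₂}b^{−1∕2}·Main` (✓`laplaceMethod_quantitative_fibred_chart_cubic_offBound`) and a rest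
`0 ≤ I − I_bulk ≤ K₃L^{q₃}b^{−θ₃}·Main` (far ∕ tip ∕ ends); (R1) of the LEAD memo — every polynomial constant is absorbed by the steepness `a` of the window. -/

/-- Auxiliary: on the window `1 ≤ L ≤ b^a`, `1 ≤ b`, a monomial `K·L^p·b^{−s}` with `s ≥ θ₀` is at most `K·L^q·b^{−θ₀}` for `p ≤ q`. [folklore] -/
theorem monomial_le_of_window {K L b s θ₀ : ℝ} {p q : ℕ} (hK : 0 ≤ K) (hL : 1 ≤ L) (hb : 1 ≤ b) (hpq : p ≤ q) (hs : θ₀ ≤ s) :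
    K * L ^ p * b ^ (-s) ≤ K * L ^ q * b ^ (-θ₀) := by
  have h1 : L ^ p ≤ L ^ q := pow_le_pow_right₀ hL hpq
  have h2 : b ^ (-s) ≤ b ^ (-θ₀) := Real.rpow_le_rpow_of_exponent_le hb (by linarith)
  have h3 : 0 ≤ b ^ (-s) := Real.rpow_nonneg (by linarith) _
  calc K * L ^ p * b ^ (-s) ≤ K * L ^ q * b ^ (-s) := by gcongr
    _ ≤ K * L ^ q * b ^ (-θ₀) := by
      refine mul_le_mul_of_nonneg_left h2 (by positivity)

/-- ★★★ **W9 — THE SHARP LOG LAW ON THE STEEP WINDOW FROM POLYNOMIAL BULK∕REST DATA.**  Let `I L b` be the quantities of interest (the sector integrals), `e L` the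
exponents, `𝔐 L > 0` the main constants, and suppose that for all `L ≥ L₀` (`L₀ ≥ 1`) and all `b ≥ K₁·L^{q₁}` there are `I_bulk`, `R` with
`I_bulk ≤ I L b ≤ I_bulk + R`, `|I_bulk − (2π∕b)^{e L}·𝔐 L| ≤ K₂L^{q₂}b^{−1∕2}·((2π∕b)^{e L}𝔐 L)` and `R ≤ K₃L^{q₃}b^{−θ₃}·((2π∕b)^{e L}𝔐 L)`.
Then there are `a > 0`, `K > 0`, `q`, `θ ∈ (0,1]`, `β₀` with, for all `b ≥ β₀` and `L ≥ L₀` in the window `L ≤ b^a`: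
`|log (I L b) − (−(e L)·log b + (log 𝔐 L + e L·log 2π))| ≤ K·L^q·b^{−θ}`.  (`θ = min(½, θ₃)`, `q = max q₂ q₃`, `K = 2(K₂+K₃)+1`,
`a = min(1∕(2q₁), θ∕(2(q+1)))`, `β₀ = max(max 1 K₁², K^{2∕θ})`.) [folklore] -/
theorem sharpLaw_on_window_of_bulk_rest {I : ℕ → ℝ → ℝ} {e 𝔐 : ℕ → ℝ} {K₁ K₂ K₃ θ₃ : ℝ} {q₁ q₂ q₃ L₀ : ℕ}
    (hK₁ : 0 < K₁) (hK₂ : 0 ≤ K₂) (hK₃ : 0 ≤ K₃) (hθ₃ : 0 < θ₃) (hq₁ : 1 ≤ q₁) (hL₀ : 1 ≤ L₀)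
    (h𝔐 : ∀ L : ℕ, L₀ ≤ L → 0 < 𝔐 L)
    (h : ∀ L : ℕ, L₀ ≤ L → ∀ b : ℝ, K₁ * (L : ℝ) ^ q₁ ≤ b → ∃ Ib R : ℝ, Ib ≤ I L b ∧ I L b ≤ Ib + R ∧
      |Ib - (2 * π / b) ^ (e L) * 𝔐 L| ≤ (K₂ * (L : ℝ) ^ q₂ * b ^ (-(1 / 2 : ℝ))) * ((2 * π / b) ^ (e L) * 𝔐 L) ∧
      R ≤ (K₃ * (L : ℝ) ^ q₃ * b ^ (-θ₃)) * ((2 * π / b) ^ (e L) * 𝔐 L)) :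
    ∃ a : ℝ, 0 < a ∧ ∃ K : ℝ, 0 < K ∧ ∃ q : ℕ, ∃ θ : ℝ, 0 < θ ∧ θ ≤ 1 ∧ ∃ β₀ : ℝ, ∀ b : ℝ, β₀ ≤ b → ∀ L : ℕ, L₀ ≤ L → (L : ℝ) ≤ b ^ a →
      0 < I L b ∧ |Real.log (I L b) - (-(e L) * Real.log b + (Real.log (𝔐 L) + e L * Real.log (2 * π)))| ≤ K * (L : ℝ) ^ q * b ^ (-θ) := by
  set θ : ℝ := min (1 / 2) θ₃ with hθdef
  have hθ0 : 0 < θ := lt_min (by norm_num) hθ₃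
  have hθ1 : θ ≤ 1 := (min_le_left _ _).trans (by norm_num)
  have hθhalf : θ ≤ 1 / 2 := min_le_left _ _
  have hθθ₃ : θ ≤ θ₃ := min_le_right _ _
  set q : ℕ := max q₂ q₃ with hqdef
  set K : ℝ := 2 * (K₂ + K₃) + 1 with hKdef
  have hK0 : 0 < K := by rw [hKdef]; linarith
  have hK1 : 1 ≤ K := by rw [hKdef]; linarith
  set a : ℝ := min (1 / (2 * (q₁ : ℝ))) (θ / (2 * ((q : ℝ) + 1))) with hadef
  have hq₁0 : (0 : ℝ) < q₁ := by exact_mod_cast hq₁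
  have hq0 : (0 : ℝ) ≤ q := Nat.cast_nonneg _
  have ha0 : 0 < a := lt_min (by positivity) (by positivity)
  set β₀ : ℝ := max (max 1 (K₁ ^ 2)) (K ^ (2 / θ)) with hβ₀def
  refine ⟨a, ha0, K, hK0, q, θ, hθ0, hθ1, β₀, fun b hb L hL hLb => ?_⟩
  -- the window facts
  have hb1 : 1 ≤ b := le_trans (le_trans (le_max_left _ _) (le_max_left _ _)) hb
  have hb0 : 0 < b := by linarith
  have hbK₁ : K₁ ^ 2 ≤ b := le_trans (le_trans (le_max_right _ _) (le_max_left _ _)) hb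
  have hbK : K ^ (2 / θ) ≤ b := le_trans (le_max_right _ _) hb
  have hL1 : (1 : ℝ) ≤ L := by exact_mod_cast hL₀.trans hL
  have hL0' : (0 : ℝ) ≤ L := by linarith
  -- (1) the polynomial threshold holds on the window
  have hLq₁ : (L : ℝ) ≤ b ^ (1 / (2 * (q₁ : ℝ))) :=
    hLb.trans (Real.rpow_le_rpow_of_exponent_le hb1 (min_le_left _ _))
  have hthr : K₁ * (L : ℝ) ^ q₁ ≤ b := mul_pow_le_of_le_rpow_window hK₁ hq₁ hb1 hbK₁ hL0' hLq₁
  obtain ⟨Ib, R, hlow, hup, hbulk, hR⟩ := h L hL b hthr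
  -- (2) the two relative errors are ≤ K₂ L^q b^{-θ}, K₃ L^q b^{-θ}
  set ε : ℝ := K₂ * (L : ℝ) ^ q₂ * b ^ (-(1 / 2 : ℝ)) with hεdef
  set ω : ℝ := K₃ * (L : ℝ) ^ q₃ * b ^ (-θ₃) with hωdef
  have hε' : ε ≤ K₂ * (L : ℝ) ^ q * b ^ (-θ) := monomial_le_of_window hK₂ hL1 hb1 (le_max_left _ _) hθhalf
  have hω' : ω ≤ K₃ * (L : ℝ) ^ q * b ^ (-θ) := monomial_le_of_window hK₃ hL1 hb1 (le_max_right _ _) hθθ₃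
  -- (3) `L^q ≤ b^{aq}` and `(K₂+K₃) b^{aq−θ} ≤ (K₂+K₃) b^{−θ/2} ≤ 1/2·…`: ε + ω ≤ 1/2
  have hLq : (L : ℝ) ^ q ≤ b ^ (a * q) := by
    calc (L : ℝ) ^ q ≤ (b ^ a) ^ q := pow_le_pow_left₀ hL0' hLb q
      _ = b ^ (a * q) := by rw [← Real.rpow_natCast, ← Real.rpow_mul hb0.le]
  have haq : a * q ≤ θ / 2 := by
    have h1 : a ≤ θ / (2 * ((q : ℝ) + 1)) := min_le_right _ _
    have h2 : a * q ≤ θ / (2 * ((q : ℝ) + 1)) * q := mul_le_mul_of_nonneg_right h1 hq0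
    refine h2.trans ?_
    rw [div_mul_eq_mul_div, div_le_div_iff₀ (by positivity) (by norm_num)]
    have : θ * (q : ℝ) * 2 ≤ θ * (2 * ((q : ℝ) + 1)) := by nlinarith [hθ0.le, hq0]
    linarith
  have hbpow : b ^ (a * q) * b ^ (-θ) ≤ b ^ (-(θ / 2)) := by
    rw [← Real.rpow_add hb0]
    exact Real.rpow_le_rpow_of_exponent_le hb1 (by linarith)
  -- `K · b^{−θ/2} ≤ 1` from `b ≥ K^{2/θ}`
  have hKb : K * b ^ (-(θ / 2)) ≤ 1 := by
    have h1 : K ≤ b ^ (θ / 2) := by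
      have h2 : (K ^ (2 / θ)) ^ (θ / 2) ≤ b ^ (θ / 2) := Real.rpow_le_rpow (by positivity) hbK (by positivity)
      rwa [← Real.rpow_mul hK0.le, show 2 / θ * (θ / 2) = 1 by field_simp, Real.rpow_one] at h2
    have h3 : 0 < b ^ (θ / 2) := Real.rpow_pos_of_pos hb0 _
    rw [Real.rpow_neg hb0.le, ← div_eq_mul_inv, div_le_one h3]
    exact h1
  have hsum : ε + ω ≤ 1 / 2 := by
    have h1 : ε + ω ≤ (K₂ + K₃) * (L : ℝ) ^ q * b ^ (-θ) := by
      have e2 : (K₂ + K₃) * (L : ℝ) ^ q * b ^ (-θ) = K₂ * (L : ℝ) ^ q * b ^ (-θ) + K₃ * (L : ℝ) ^ q * b ^ (-θ) := by ring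
      rw [e2]; exact add_le_add hε' hω'
    have h2 : (K₂ + K₃) * (L : ℝ) ^ q * b ^ (-θ) ≤ (K₂ + K₃) * (b ^ (a * q) * b ^ (-θ)) := by
      rw [mul_assoc]
      exact mul_le_mul_of_nonneg_left (mul_le_mul_of_nonneg_right hLq (Real.rpow_nonneg hb0.le _)) (by positivity)
    have h3 : (K₂ + K₃) * (b ^ (a * q) * b ^ (-θ)) ≤ (K₂ + K₃) * b ^ (-(θ / 2)) := mul_le_mul_of_nonneg_left hbpow (by positivity)
    have h4 : (K₂ + K₃) * b ^ (-(θ / 2)) ≤ 1 / 2 := by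
      have : 2 * (K₂ + K₃) * b ^ (-(θ / 2)) ≤ K * b ^ (-(θ / 2)) :=
        mul_le_mul_of_nonneg_right (by rw [hKdef]; linarith) (Real.rpow_nonneg hb0.le _)
      linarith
    linarith
  -- (4) the log law at this `b`
  have hbulk' : |Ib - (2 * π / b) ^ (2 * e L / 2) * 𝔐 L| ≤ ε * ((2 * π / b) ^ (2 * e L / 2) * 𝔐 L) := by
    rw [show 2 * e L / 2 = e L by ring]; exact hbulk
  have hR' : R ≤ ω * ((2 * π / b) ^ (2 * e L / 2) * 𝔐 L) := by
    rw [show 2 * e L / 2 = e L by ring]; exact hR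
  obtain ⟨hIpos, hlog⟩ := abs_log_sharp_of_bulk_rest (m := 2 * e L) (h𝔐 L hL) hb0 hlow hup hbulk' hR' hsum
  refine ⟨hIpos, ?_⟩
  have e1 : Real.log (𝔐 L) + 2 * e L / 2 * Real.log (2 * π) - 2 * e L / 2 * Real.log b =
      -(e L) * Real.log b + (Real.log (𝔐 L) + e L * Real.log (2 * π)) := by ring
  rw [e1] at hlog
  refine hlog.trans ?_
  -- `2(ε + ω) ≤ 2(K₂+K₃) L^q b^{−θ} ≤ K L^q b^{−θ}`
  have hmono : 0 ≤ (L : ℝ) ^ q * b ^ (-θ) := by positivity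
  have e3 : K * (L : ℝ) ^ q * b ^ (-θ) = 2 * (K₂ * (L : ℝ) ^ q * b ^ (-θ) + K₃ * (L : ℝ) ^ q * b ^ (-θ)) + (L : ℝ) ^ q * b ^ (-θ) := by
    rw [hKdef]; ring
  rw [e3]
  have h5 := add_le_add hε' hω'
  linarith

end Summit.QuantumFields.YangMills.Theorems.QuantitativeLaplace

end
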